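import Mathlib
import Literature.NumberTheory.LFunctions.NumHelpers
import Summits.QuantumFields.BalabanUV.Beta.EriceRemainderEnclosureHistoryAutonomyComparisonAgeCompositionStaticChainHyperbolic
import Summits.QuantumFields.BalabanUV.Beta.EriceRemainderEnclosureHistoryAutonomyComparisonAgeCompositionStaticChainBandTemplate
import Summits.QuantumFields.BalabanUV.Beta.EriceRemainderEnclosureHistoryAutonomyComparisonAgeCompositionStaticChainBandsA
import Summits.QuantumFields.BalabanUV.Beta.EriceRemainderEnclosureHistoryAutonomyComparisonAgeCompositionStaticChainBandsB
import Summits.QuantumFields.BalabanUV.Beta.EriceRemainderEnclosureHistoryAutonomyComparisonAgeCompositionStaticChainBandsC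

/-!
# EriceRemainderEnclosureHistoryAutonomyComparisonAgeCompositionStaticChainBandsMid — (E79n) THE OBSERVER STEP ABOVE EVERY PAIR OF THE MID RANGE
# `3∕10 ≤ z∕y ≤ 4∕5` (`q = y∕z ∈ [1.25, 3.33]`), `y ≥ 24`: the ten band packages (E79k–m) through the band template (E79j), with the defect hypothesis in its
# natural form `θ ≤ θ̄(y∕z)`

Cell `pub-balaban`, β-function sub-cell, BINDER row D4 «RemainderConst leaves for Bałaban's split» (`HOME/BINDER-OWNERS.md`; owner lineage `b2b-balaban-beta-an4`;
this file by co-owner #2 lineage `b2b-balaban-beta-d4-p2`, generation 70), β-FLOW TEAM duty (1), FREEZE (0) honoured (def-free; imports `…Hyperbolic` (`thetabar_antitone`),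
(E79j) `…BandTemplate` (`band_pair_step_lattice`), (E79k–m) `…BandsA∕B∕C` (the ten packages), `Literature/…/NumHelpers`; nothing restated).

HONEST FRAMING (page 1, verbatim and binding).  *"Discharging BetaPertH makes Bałaban's UV stability UNCONDITIONAL — a real constructive-QFT result; it is
NOT the continuum limit and NOT the Clay problem."*  THIS FILE DISCHARGES NOTHING OF THE KIND.  A ten-way case analysis on a rational ratio plus tree theorems —
hypotheses of a census, not facts; the age profile of Bałaban's (1.22) limit functional is NOT PRINTED ([I] p. 298; GAPS G-t4-U2-1∕-2) and NOT asserted.  Row D4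
class UNCHANGED (critical-path width 0; instance 0∕1; D4 DISCHARGE NO DATE).  HONEST DEPENDENCY: continuum YM on T⁴ ⇐ BetaPertH ∧ nine spine estimates (0/9
proved); BetaPertH ⇐ (D1) ∧ (D4) ∧ CAP+tail; G-an2-4 gates asym, D1 and NE2/3/4.

THE POINT (census sense (α); route (N′); README `HOME/b2b-balaban-beta-d4-p2/g70/e79/README.md` §4).  The first quotable NON-ADJACENT result of the band machine:
§2 **`band_step_lattice_mid`** — for every pair of scales with `3∕10 ≤ z∕y ≤ 4∕5` and `y ≥ 24`, every level-coupled configuration of older ages `k_l ≥ y+1`, every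
admissible load, the observer bound `N_z ≤ (1+2κΨ_zz)(1−Ω_z)` PROPAGATES through the addition of the age `y` (`κ = 31∕40`), with the defect hypothesis in its
NATURAL form `θ ≤ θ̄(y∕z) = 1 − (q∕(q+1))^{3∕2}e^{−1∕(2q)}` (§1 `thetabar_le_band`: `θ̄(q) ≤ th` on a band from `thetabar_antitone` and `e^{−x} ≥ 1 − x`).  Together
with (E79g) (adjacent pairs, all `z`) this covers, above the threshold, the scale ratios `q ∈ {(z+1)∕z} ∪ [1.25, 3.33]`.  WHAT REMAINS (README §4–§5): the
near-diagonal bands `4∕5 < r < 1` (band-inflated spread `D`; per-pair spreads or narrower bands), `r < 3∕10` (narrow∕far bands with (E79h)), the finitely many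
pairs below the thresholds (pair template), then the assembly.  NOT CLAIMED: those; the static closure; anything about the flow; printed.

WHAT IS PROVED ([folklore]; 0 `def`, 0 sorry).  §1 `thetabar_le_band`.  §2 **`band_step_lattice_mid`**.
-/
noncomputable section
open Finset

namespace Summit.QuantumFields.BalabanUV.Beta.EriceRemainderEnclosureHistoryAutonomyComparisonAgeCompositionStaticChainBandsMid

open Summit.QuantumFields.BalabanUV.Beta.EriceRemainderEnclosureHistoryAutonomyComparisonAgeCompositionStaticChainHyperbolic
open Summit.QuantumFields.BalabanUV.Beta.EriceRemainderEnclosureHistoryAutonomyComparisonAgeCompositionStaticChainBandTemplate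
open Summit.QuantumFields.BalabanUV.Beta.EriceRemainderEnclosureHistoryAutonomyComparisonAgeCompositionStaticChainBandsA
open Summit.QuantumFields.BalabanUV.Beta.EriceRemainderEnclosureHistoryAutonomyComparisonAgeCompositionStaticChainBandsB
open Summit.QuantumFields.BalabanUV.Beta.EriceRemainderEnclosureHistoryAutonomyComparisonAgeCompositionStaticChainBandsC
open Literature.NumberTheory.LFunctions.VdC.Num (le_sqrt_of_sq_le)

/-! ## §1 The defect envelope of a band -/

/-- **`θ̄(q) ≤ th` ON A BAND.**  For `q ≥ ql > 0` (`2ql ≥ 1`): `θ̄(q) ≤ θ̄(ql)` ((E78-Hyperbolic) `thetabar_antitone`) and `θ̄(ql) = 1 − c√c·e^{−1∕(2ql)}` with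
`c = ql∕(ql+1)`, `e^{−x} ≥ 1 − x` (`Real.add_one_le_exp`); so `θ̄(q) ≤ th` whenever `Lc ≤ √c` and `1 − c·Lc·(1 − 1∕(2ql)) ≤ th`. [folklore] -/
theorem thetabar_le_band {q ql Lc th : ℝ} (hql : 0 < ql) (hq : ql ≤ q) (hLc : Lc ≤ Real.sqrt (ql / (ql + 1))) (h2 : 1 ≤ 2 * ql)
    (hth : 1 - ql / (ql + 1) * Lc * (1 - 1 / (2 * ql)) ≤ th) :
    1 - q / (q + 1) * Real.sqrt (q / (q + 1)) * Real.exp (-(1 / (2 * q))) ≤ th := by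
  refine (thetabar_antitone hql hq).trans ?_
  have hc0 : 0 ≤ ql / (ql + 1) := by positivity
  have hE : 1 - 1 / (2 * ql) ≤ Real.exp (-(1 / (2 * ql))) := by
    have := Real.add_one_le_exp (-(1 / (2 * ql))); linarith
  have hE0 : 0 ≤ 1 - 1 / (2 * ql) := by
    rw [sub_nonneg, div_le_one (by positivity)]; linarith
  have h1 : ql / (ql + 1) * Lc * (1 - 1 / (2 * ql)) ≤ ql / (ql + 1) * Real.sqrt (ql / (ql + 1)) * Real.exp (-(1 / (2 * ql))) :=
    mul_le_mul (mul_le_mul_of_nonneg_left hLc hc0) hE hE0 (mul_nonneg hc0 (Real.sqrt_nonneg _))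
  linarith

/-! ## §2 The mid range -/

/-- **THE OBSERVER STEP (◆) ABOVE EVERY PAIR WITH `3∕10 ≤ z∕y ≤ 4∕5`, `y ≥ 24`, FOR EVERY LEVEL-COUPLED CONFIGURATION AND EVERY ADMISSIBLE LOAD** (`κ = 31∕40`; the
hypothesis `hdia` of (E78a) `observer_step`; the defect hypothesis is `θ ≤ θ̄(y∕z)` itself).  Proof: locate `z∕y` in one of the ten bands of width `1∕20` and apply
(E79j) `band_pair_step_lattice` with the package of (E79k–m); the band's defect constant by §1. [folklore] -/
theorem band_step_lattice_mid {n y z : ℕ} {k : ℕ → ℕ} {x a cy cz Sy Sz Ry Rz : ℕ → ℝ} {θ xy Ψyy Ψyz Ψzy Ψzz Ωz σ φ s : ℝ}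
    (hy : 24 ≤ y) (hlo : (3/10:ℝ) * y ≤ z) (hhi : (z : ℝ) ≤ (4/5:ℝ) * y)
    (hn : 0 < n) (hk : ∀ l, l < n → y + 1 ≤ k l) (hx : ∀ l, l < n → 0 ≤ x l)
    (hSy : ∀ l, l < n → Sy l = ∑ m ∈ range y, Real.sqrt ((k l : ℝ) / ((k l : ℝ) + m + 1)))
    (hSz : ∀ l, l < n → Sz l = ∑ m ∈ range z, Real.sqrt ((k l : ℝ) / ((k l : ℝ) + m + 1)))
    (hRy : ∀ l, l < n → Ry l = ∑ m ∈ range (k l), Real.sqrt ((y : ℝ) / ((y : ℝ) + m + 1)))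
    (hRz : ∀ l, l < n → Rz l = ∑ m ∈ range (k l), Real.sqrt ((z : ℝ) / ((z : ℝ) + m + 1)))
    (ha0 : ∀ i, i < n → 0 < a i)
    (ha : ∀ i, i < n → a i = 1 + ∑ l ∈ range n,
      (2 * x l * (∑ m ∈ range (k i), Real.sqrt ((k l : ℝ) / ((k l : ℝ) + m + 1))) / k l) * a l)
    (hcy : ∀ i, i < n → cy i = Ry i / (y : ℝ) + ∑ l ∈ range n,
      (2 * x l * (∑ m ∈ range (k i), Real.sqrt ((k l : ℝ) / ((k l : ℝ) + m + 1))) / k l) * cy l)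
    (hcz : ∀ i, i < n → cz i = Rz i / (z : ℝ) + ∑ l ∈ range n,
      (2 * x l * (∑ m ∈ range (k i), Real.sqrt ((k l : ℝ) / ((k l : ℝ) + m + 1))) / k l) * cz l)
    (hΨyy : Ψyy = ∑ l ∈ range n, (2 * x l * Sy l / k l) * cy l) (hΨyz : Ψyz = ∑ l ∈ range n, (2 * x l * Sz l / k l) * cy l)
    (hΨzy : Ψzy = ∑ l ∈ range n, (2 * x l * Sy l / k l) * cz l) (hΨzz : Ψzz = ∑ l ∈ range n, (2 * x l * Sz l / k l) * cz l)
    (hΩz : Ωz = ∑ l ∈ range n, x l * (z : ℝ) / k l)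
    (hσ : σ = (∑ m ∈ range z, Real.sqrt ((y : ℝ) / ((y : ℝ) + m + 1))) / (y : ℝ))
    (hφ : φ = (∑ m ∈ range y, Real.sqrt ((z : ℝ) / ((z : ℝ) + m + 1))) / (z : ℝ))
    (hs : s = (∑ m ∈ range y, Real.sqrt ((y : ℝ) / ((y : ℝ) + m + 1))) / (y : ℝ))
    (hθ : θ ≤ 1 - ((y : ℝ) / z) / ((y : ℝ) / z + 1) * Real.sqrt (((y : ℝ) / z) / ((y : ℝ) / z + 1)) * Real.exp (-(1 / (2 * ((y : ℝ) / z)))))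
    (hxy : 0 ≤ xy) (hcap : 2 * xy * (s + Ψyy) < 1) :
    (1 + 2 * (31/40:ℝ) * Ψzz) * (1 - Ωz) - (1 - θ) * (xy * (1 + 2 * (31/40:ℝ) * Ψyy))
      ≤ (1 - xy * (1 + 2 * (31/40:ℝ) * Ψyy)) *
        ((1 + 2 * (31/40:ℝ) * Ψzz + 4 * (31/40:ℝ) * xy * ((σ + Ψyz) * (φ + Ψzy)) / (1 - 2 * (s + Ψyy) * xy)) * ((1 - Ωz) - xy / ((y : ℝ) / (z : ℝ)))) := by
  have hy' : (24 : ℝ) ≤ y := by exact_mod_cast hy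
  have hz8 : 8 ≤ z := by
    by_contra h
    have : (z : ℝ) ≤ 7 := by exact_mod_cast (show z ≤ 7 by omega)
    linarith
  have hz1 : 1 ≤ z := by omega
  have hzy : z + 1 ≤ y := by
    have : (z : ℝ) + 1 ≤ y := by linarith
    exact_mod_cast this
  have hzp : (0 : ℝ) < z := by exact_mod_cast (show 0 < z by omega)
  by_cases c0 : (z : ℝ) ≤ (7/20:ℝ) * y
  · have hzlo : 8 ≤ z := by
      by_contra h
      have : (z : ℝ) ≤ 7 := by exact_mod_cast (show z ≤ 7 by omega)
      linarith [show (3/10:ℝ) * (y : ℝ) ≤ z from hlo]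
    exact band_pair_step_lattice (rl := (3/10:ℝ)) (rh := (7/20:ℝ)) (y0 := 24) (z0 := 8) (th := (4741/10000:ℝ)) (by norm_num) (by norm_num) (by omega) hzlo hz1 hzy hlo c0 facts_band_3_10_to_7_20
      hn hk hx hSy hSz hRy hRz ha0 ha hcy hcz hΨyy hΨyz hΨzy hΨzz hΩz hσ hφ hs
      (hθ.trans (thetabar_le_band (ql := (20/7:ℝ)) (Lc := (430331/500000:ℝ)) (by norm_num) (by rw [le_div_iff₀ hzp]; linarith) (le_sqrt_of_sq_le (by norm_num) (by norm_num)) (by norm_num) (by norm_num))) hxy hcap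
  by_cases c1 : (z : ℝ) ≤ (2/5:ℝ) * y
  · have hzlo : 6 ≤ z := by
      by_contra h
      have : (z : ℝ) ≤ 5 := by exact_mod_cast (show z ≤ 5 by omega)
      linarith [show (7/20:ℝ) * (y : ℝ) ≤ z from (not_le.mp c0).le]
    exact band_pair_step_lattice (rl := (7/20:ℝ)) (rh := (2/5:ℝ)) (y0 := 16) (z0 := 6) (th := (5171/10000:ℝ)) (by norm_num) (by norm_num) (by omega) hzlo hz1 hzy (not_le.mp c0).le c1 facts_band_7_20_to_2_5
      hn hk hx hSy hSz hRy hRz ha0 ha hcy hcz hΨyy hΨyz hΨzy hΨzz hΩz hσ hφ hs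
      (hθ.trans (thetabar_le_band (ql := (5/2:ℝ)) (Lc := (422577/500000:ℝ)) (by norm_num) (by rw [le_div_iff₀ hzp]; linarith) (le_sqrt_of_sq_le (by norm_num) (by norm_num)) (by norm_num) (by norm_num))) hxy hcap
  by_cases c2 : (z : ℝ) ≤ (9/20:ℝ) * y
  · have hzlo : 7 ≤ z := by
      by_contra h
      have : (z : ℝ) ≤ 6 := by exact_mod_cast (show z ≤ 6 by omega)
      linarith [show (2/5:ℝ) * (y : ℝ) ≤ z from (not_le.mp c1).le]
    exact band_pair_step_lattice (rl := (2/5:ℝ)) (rh := (9/20:ℝ)) (y0 := 16) (z0 := 7) (th := (2781/5000:ℝ)) (by norm_num) (by norm_num) (by omega) hzlo hz1 hzy (not_le.mp c1).le c2 facts_band_2_5_to_9_20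
      hn hk hx hSy hSz hRy hRz ha0 ha hcy hcz hΨyy hΨyz hΨzy hΨzz hΩz hσ hφ hs
      (hθ.trans (thetabar_le_band (ql := (20/9:ℝ)) (Lc := (415227/500000:ℝ)) (by norm_num) (by rw [le_div_iff₀ hzp]; linarith) (le_sqrt_of_sq_le (by norm_num) (by norm_num)) (by norm_num) (by norm_num))) hxy hcap
  by_cases c3 : (z : ℝ) ≤ (1/2:ℝ) * y
  · have hzlo : 8 ≤ z := by
      by_contra h
      have : (z : ℝ) ≤ 7 := by exact_mod_cast (show z ≤ 7 by omega)
      linarith [show (9/20:ℝ) * (y : ℝ) ≤ z from (not_le.mp c2).le]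
    exact band_pair_step_lattice (rl := (9/20:ℝ)) (rh := (1/2:ℝ)) (y0 := 16) (z0 := 8) (th := (2959/5000:ℝ)) (by norm_num) (by norm_num) (by omega) hzlo hz1 hzy (not_le.mp c2).le c3 facts_band_9_20_to_1_2
      hn hk hx hSy hSz hRy hRz ha0 ha hcy hcz hΨyy hΨyz hΨzy hΨzz hΩz hσ hφ hs
      (hθ.trans (thetabar_le_band (ql := (2:ℝ)) (Lc := (51031/62500:ℝ)) (by norm_num) (by rw [le_div_iff₀ hzp]; linarith) (le_sqrt_of_sq_le (by norm_num) (by norm_num)) (by norm_num) (by norm_num))) hxy hcap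
  by_cases c4 : (z : ℝ) ≤ (11/20:ℝ) * y
  · have hzlo : 8 ≤ z := by
      by_contra h
      have : (z : ℝ) ≤ 7 := by exact_mod_cast (show z ≤ 7 by omega)
      linarith [show (1/2:ℝ) * (y : ℝ) ≤ z from (not_le.mp c3).le]
    exact band_pair_step_lattice (rl := (1/2:ℝ)) (rh := (11/20:ℝ)) (y0 := 16) (z0 := 8) (th := (1561/2500:ℝ)) (by norm_num) (by norm_num) (by omega) hzlo hz1 hzy (not_le.mp c3).le c4 facts_band_1_2_to_11_20
      hn hk hx hSy hSz hRy hRz ha0 ha hcy hcz hΨyy hΨyz hΨzy hΨzz hΩz hσ hφ hs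
      (hθ.trans (thetabar_le_band (ql := (20/11:ℝ)) (Lc := (803219/1000000:ℝ)) (by norm_num) (by rw [le_div_iff₀ hzp]; linarith) (le_sqrt_of_sq_le (by norm_num) (by norm_num)) (by norm_num) (by norm_num))) hxy hcap
  by_cases c5 : (z : ℝ) ≤ (3/5:ℝ) * y
  · have hzlo : 9 ≤ z := by
      by_contra h
      have : (z : ℝ) ≤ 8 := by exact_mod_cast (show z ≤ 8 by omega)
      linarith [show (11/20:ℝ) * (y : ℝ) ≤ z from (not_le.mp c4).le]
    exact band_pair_step_lattice (rl := (11/20:ℝ)) (rh := (3/5:ℝ)) (y0 := 16) (z0 := 9) (th := (3271/5000:ℝ)) (by norm_num) (by norm_num) (by omega) hzlo hz1 hzy (not_le.mp c4).le c5 facts_band_11_20_to_3_5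
      hn hk hx hSy hSz hRy hRz ha0 ha hcy hcz hΨyy hΨyz hΨzy hΨzz hΩz hσ hφ hs
      (hθ.trans (thetabar_le_band (ql := (5/3:ℝ)) (Lc := (790569/1000000:ℝ)) (by norm_num) (by rw [le_div_iff₀ hzp]; linarith) (le_sqrt_of_sq_le (by norm_num) (by norm_num)) (by norm_num) (by norm_num))) hxy hcap
  by_cases c6 : (z : ℝ) ≤ (13/20:ℝ) * y
  · have hzlo : 10 ≤ z := by
      by_contra h
      have : (z : ℝ) ≤ 9 := by exact_mod_cast (show z ≤ 9 by omega)
      linarith [show (3/5:ℝ) * (y : ℝ) ≤ z from (not_le.mp c5).le]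
    exact band_pair_step_lattice (rl := (3/5:ℝ)) (rh := (13/20:ℝ)) (y0 := 16) (z0 := 10) (th := (426/625:ℝ)) (by norm_num) (by norm_num) (by omega) hzlo hz1 hzy (not_le.mp c5).le c6 facts_band_3_5_to_13_20
      hn hk hx hSy hSz hRy hRz ha0 ha hcy hcz hΨyy hΨyz hΨzy hΨzz hΩz hσ hφ hs
      (hθ.trans (thetabar_le_band (ql := (20/13:ℝ)) (Lc := (389249/500000:ℝ)) (by norm_num) (by rw [le_div_iff₀ hzp]; linarith) (le_sqrt_of_sq_le (by norm_num) (by norm_num)) (by norm_num) (by norm_num))) hxy hcap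
  by_cases c7 : (z : ℝ) ≤ (7/10:ℝ) * y
  · have hzlo : 11 ≤ z := by
      by_contra h
      have : (z : ℝ) ≤ 10 := by exact_mod_cast (show z ≤ 10 by omega)
      linarith [show (13/20:ℝ) * (y : ℝ) ≤ z from (not_le.mp c6).le]
    exact band_pair_step_lattice (rl := (13/20:ℝ)) (rh := (7/10:ℝ)) (y0 := 16) (z0 := 11) (th := (1767/2500:ℝ)) (by norm_num) (by norm_num) (by omega) hzlo hz1 hzy (not_le.mp c6).le c7 facts_band_13_20_to_7_10
      hn hk hx hSy hSz hRy hRz ha0 ha hcy hcz hΨyy hΨyz hΨzy hΨzz hΩz hσ hφ hs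
      (hθ.trans (thetabar_le_band (ql := (10/7:ℝ)) (Lc := (191741/250000:ℝ)) (by norm_num) (by rw [le_div_iff₀ hzp]; linarith) (le_sqrt_of_sq_le (by norm_num) (by norm_num)) (by norm_num) (by norm_num))) hxy hcap
  by_cases c8 : (z : ℝ) ≤ (3/4:ℝ) * y
  · have hzlo : 12 ≤ z := by
      by_contra h
      have : (z : ℝ) ≤ 11 := by exact_mod_cast (show z ≤ 11 by omega)
      linarith [show (7/10:ℝ) * (y : ℝ) ≤ z from (not_le.mp c7).le]
    exact band_pair_step_lattice (rl := (7/10:ℝ)) (rh := (3/4:ℝ)) (y0 := 16) (z0 := 12) (th := (7301/10000:ℝ)) (by norm_num) (by norm_num) (by omega) hzlo hz1 hzy (not_le.mp c7).le c8 facts_band_7_10_to_3_4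
      hn hk hx hSy hSz hRy hRz ha0 ha hcy hcz hΨyy hΨyz hΨzy hΨzz hΩz hσ hφ hs
      (hθ.trans (thetabar_le_band (ql := (4/3:ℝ)) (Lc := (94491/125000:ℝ)) (by norm_num) (by rw [le_div_iff₀ hzp]; linarith) (le_sqrt_of_sq_le (by norm_num) (by norm_num)) (by norm_num) (by norm_num))) hxy hcap
  have hzlo : 18 ≤ z := by
    by_contra h
    have : (z : ℝ) ≤ 17 := by exact_mod_cast (show z ≤ 17 by omega)
    linarith [show (3/4:ℝ) * (y : ℝ) ≤ z from (not_le.mp c8).le]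
  exact band_pair_step_lattice (rl := (3/4:ℝ)) (rh := (4/5:ℝ)) (y0 := 24) (z0 := 18) (th := (1879/2500:ℝ)) (by norm_num) (by norm_num) (by omega) hzlo hz1 hzy (not_le.mp c8).le hhi facts_band_3_4_to_4_5
    hn hk hx hSy hSz hRy hRz ha0 ha hcy hcz hΨyy hΨyz hΨzy hΨzz hΩz hσ hφ hs
    (hθ.trans (thetabar_le_band (ql := (5/4:ℝ)) (Lc := (149071/200000:ℝ)) (by norm_num) (by rw [le_div_iff₀ hzp]; linarith) (le_sqrt_of_sq_le (by norm_num) (by norm_num)) (by norm_num) (by norm_num))) hxy hcap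

end Summit.QuantumFields.BalabanUV.Beta.EriceRemainderEnclosureHistoryAutonomyComparisonAgeCompositionStaticChainBandsMid

end
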